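import Mathlib
import Summits.Ventures.PercRepro2.HMFOEdge
import Summits.Ventures.PercRepro2.HMFOEdgeB2

/-!
# The first-order coefficient at `a₃ = o` splits into a glued BHK bracket and a residual bracket
(blind cell PercRepro2, night-1 g17; NIGHT1-G17.md §4′)

At the sure edge `f = {a₃, o}` (`p f = 1`) the cofactor `Φ_o` of `OEdge.HMFc_eq_factor_o` is the
first-order coefficient of the mean field at the coincidence `a₃ = o`.  With
`S₃ = P(Q, oL) − P(Q, oH)` and `Z − S₃ = D + 2 P(Q, oH)` in the glued instance (`D = P(Q, o ∉ U)`),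
and `EQo⁰ − S₃o⁰ = D_oL⁰ − D_oH⁰ + 2 P⁰(T, oL) − 2 P⁰(T′, oH)` in the instance without the edge:

* **`PhiO_eq_split`**: `Φ_o = 2 D · B₁ + 2 D_o⁰ · B₂` with
  `B₂ = Z (M₂ + Δ_T) − gap · P(Q, oH)` (the glued bracket, `≥ 0` by `OEdge.B2_nonneg`) and
  `B₁ = −Z X̂⁰ + gap (P⁰(T, oL) − P⁰(T′, oH) − D_oH⁰)` (the residual bracket, indefinite);
* **`PhiO_nonneg_of_B1`**: `0 ≤ B₁ → 0 ≤ Φ_o` at the sure edge — the candidate row (FO-o) follows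
  from the sign of the residual bracket alone (which, however, is negative on about half of the
  random instances: the row is a genuinely two-term inequality).

Own code; standard axioms.
-/

namespace Summit.Ventures.PercRepro2

open UnionCluster CovForm

namespace OEdge

section Split

variable {V : Type*} {E : Type*} [Fintype E] [DecidableEq E] [Fintype V] [DecidableEq V]
  {R : Type*} [Field R] [LinearOrder R] [IsStrictOrderedRing R]

variable (p : E → R) (ends : E → Sym2 V) (o a₁ a₂ a₃ b : V) {f : E}

omit [Fintype V] [DecidableEq V] [LinearOrder R] [IsStrictOrderedRing R] in
/-- At the sure edge, `E_Q[σ₃] = P(Q, oL) − P(Q, oH)`. -/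
lemma EQ3_of_sure_o (hf : ends f = s(a₃, o)) (h1 : p f = 1) :
    EQ3 p ends a₁ a₂ a₃ =
      prob p (avoidAll ends a₂ {a₁} ∩ connEvent ends a₁ o) -
        prob p (avoidAll ends a₂ {a₁} ∩ connEvent ends a₂ o) := by
  unfold EQ3
  rw [SureEdge.prob_T' p h1 hf a₁ a₂, SureEdge.prob_T' p h1 hf a₂ a₁, (Coinc.T_o_eq ends o a₁ a₂).1,
    (Coinc.T_o_eq ends o a₁ a₂).2]

omit [Fintype V] [LinearOrder R] [IsStrictOrderedRing R] in
/-- At the sure edge, `P(PD) = P(Q) − P(Q, oL) − P(Q, oH)` (the three-way split of `Q` by the side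
of `o`; `PD = Q ∩ {o ∉ U}` there). -/
lemma prob_PD_of_sure_o (hf : ends f = s(a₃, o)) (h1 : p f = 1) :
    prob p (PDEvent ends a₁ a₂ a₃) =
      prob p (avoidAll ends a₂ {a₁}) - prob p (avoidAll ends a₂ {a₁} ∩ connEvent ends a₁ o) -
        prob p (avoidAll ends a₂ {a₁} ∩ connEvent ends a₂ o) := by
  rw [SureEdge.prob_PD' p h1 hf a₁ a₂]
  have hs := CovForm.Qsplit_univ p ends a₁ a₂ o
  rw [(Coinc.T_o_eq ends o a₁ a₂).1, (Coinc.T_o_eq ends o a₁ a₂).2] at hs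
  linear_combination -hs

omit [Fintype V] [LinearOrder R] [IsStrictOrderedRing R] in
/-- `EQo − EQ3o = D_oL − D_oH + 2 P(T, oL) − 2 P(T′, oH)` (the three-way split of `Q` by the side of
`a₃`, on `{o ∈ C₁}` and `{o ∈ C₂}`). -/
lemma EQo_sub_EQ3o_eq (q : E → R) :
    EQo q ends o a₁ a₂ - EQ3o q ends o a₁ a₂ a₃ =
      prob q (PDEvent ends a₁ a₂ a₃ ∩ connEvent ends a₁ o) -
        prob q (PDEvent ends a₁ a₂ a₃ ∩ connEvent ends a₂ o) +
        2 * prob q (TEvent ends a₁ a₂ a₃ ∩ connEvent ends a₁ o) -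
        2 * prob q (TEvent ends a₂ a₁ a₃ ∩ connEvent ends a₂ o) := by
  unfold EQo EQ3o
  rw [CovForm.Qsplit q ends a₁ a₂ a₃ (connEvent ends a₁ o),
    CovForm.Qsplit q ends a₁ a₂ a₃ (connEvent ends a₂ o)]
  ring

omit [LinearOrder R] [IsStrictOrderedRing R] in
/-- **The split of the first-order coefficient at `a₃ = o`**:
`Φ_o = 2 D · B₁ + 2 D_o⁰ · B₂` at the sure edge. -/
theorem PhiO_eq_split (hf : ends f = s(a₃, o)) (h1 : p f = 1) :
    PhiO p ends o a₁ a₂ a₃ b f =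
      2 * prob p (PDEvent ends a₁ a₂ a₃) *
          (-(prob p (avoidAll ends a₂ {a₁}) * Xhat (Function.update p f 0) ends o a₁ a₂ a₃ b) +
            gap p ends a₁ a₂ b *
              (prob (Function.update p f 0) (TEvent ends a₁ a₂ a₃ ∩ connEvent ends a₁ o) -
                prob (Function.update p f 0) (TEvent ends a₂ a₁ a₃ ∩ connEvent ends a₂ o) -
                prob (Function.update p f 0) (PDEvent ends a₁ a₂ a₃ ∩ connEvent ends a₂ o))) +
        2 * Do (Function.update p f 0) ends o a₁ a₂ a₃ *
          (prob p (avoidAll ends a₂ {a₁}) * (massM2 p ends a₁ a₂ a₃ b + deltaT p ends a₁ a₂ a₃ b) -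
            gap p ends a₁ a₂ b * prob p (avoidAll ends a₂ {a₁} ∩ connEvent ends a₂ o)) := by
  unfold PhiO
  rw [EQ3_of_sure_o p ends o a₁ a₂ a₃ hf h1, EQo_sub_EQ3o_eq ends o a₁ a₂ a₃,
    prob_PD_of_sure_o p ends o a₁ a₂ a₃ hf h1]
  unfold CovForm.Do
  ring

/-- **(FO-o) from the residual bracket**: at the sure edge, `0 ≤ B₁` gives `0 ≤ Φ_o`. -/
theorem PhiO_nonneg_of_B1 (hp : IsProbVec p) (hf : ends f = s(a₃, o)) (h1 : p f = 1)
    (hB1 : 0 ≤ -(prob p (avoidAll ends a₂ {a₁}) * Xhat (Function.update p f 0) ends o a₁ a₂ a₃ b) +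
      gap p ends a₁ a₂ b *
        (prob (Function.update p f 0) (TEvent ends a₁ a₂ a₃ ∩ connEvent ends a₁ o) -
          prob (Function.update p f 0) (TEvent ends a₂ a₁ a₃ ∩ connEvent ends a₂ o) -
          prob (Function.update p f 0) (PDEvent ends a₁ a₂ a₃ ∩ connEvent ends a₂ o))) :
    0 ≤ PhiO p ends o a₁ a₂ a₃ b f := by
  rw [PhiO_eq_split p ends o a₁ a₂ a₃ b hf h1]
  have hD : 0 ≤ prob p (PDEvent ends a₁ a₂ a₃) := prob_nonneg hp _
  have hDo : 0 ≤ Do (Function.update p f 0) ends o a₁ a₂ a₃ := by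
    unfold CovForm.Do
    have := prob_nonneg (hp.update f le_rfl zero_le_one)
      (PDEvent ends a₁ a₂ a₃ ∩ connEvent ends a₁ o)
    have := prob_nonneg (hp.update f le_rfl zero_le_one)
      (PDEvent ends a₁ a₂ a₃ ∩ connEvent ends a₂ o)
    linarith
  -- the glued bracket with the mark `a₃` relabelled to `o`
  have hB2 := B2_nonneg p ends o a₁ a₂ b hp
  have hM2 : massM2 p ends a₁ a₂ a₃ b = massM2 p ends a₁ a₂ o b := by
    unfold massM2; rw [SureEdge.prob_PD p h1 hf a₁ a₂]
  have hdT : deltaT p ends a₁ a₂ a₃ b = deltaT p ends a₁ a₂ o b := by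
    unfold deltaT; rw [SureEdge.prob_T'' p h1 hf a₁ a₂, SureEdge.prob_T'' p h1 hf a₁ a₂]
  rw [hM2, hdT]
  have := mul_nonneg hD hB1
  have := mul_nonneg hDo hB2
  nlinarith

end Split

end OEdge

end Summit.Ventures.PercRepro2
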